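import Summits.ResolutionOfSingularities.ResolutionOfSingularities.Theorems.FrobeniusLadderFInjectiveMacaulayficationOmegaOneActualChart22CM
import Mathlib.Algebra.MvPolynomial.Division
import HarnessLib

/-!
# BED Ω, GLOBAL PATCH (g-b), F4 (c) ON THE ACTUAL CHARTS 4, 5, 18, 23 OF `X̃_{B9}`: the pencil chart rings of `S′_{Ω₁}` are codimension-2 complete intersections `k[y, W]/(θ_c, a′W − b′)`,
# `k[y, U]/(θ_c, b′U − a′)`, Cohen–Macaulay AT EVERY STALK, every field (companion of ✓p707995, chart 22; letters from ✓p703845 `B9OmegaChartLetters`)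
# (crux `FInjectiveMacaulayfication` stmt-ResolutionOfSingularities-15315, chain w45a; R23.23 (1) file F4 (c); seat res-L1-w45a-stub-3 g13)

[OURS · L1 W4.5a] Support file (`--supports stmt-ResolutionOfSingularities-15315 --as helper`); theorems only; no named fact; NOT a statement of any manuscript; nothing of the crux is proved.
As in ✓p707995 the rings are the Stacks-0BIQ presentations of the two Rees charts of `Bl_{(a′,b′)}(U_c ∩ X̃)`, `(a′, b′) = 𝒥|_{U_c}` with its invertible monomial factor removed; the
identification glue with `S′|_{U_c}` is NOT done here. LETTERS per chart put the `θ_c`-defining variable FIRST (`X 0`) so that ✓ `prime_pencilPhiAffine` applies; `X 5 = W` (resp. `U`):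
* CHART 4: `X 0..4 = y₃, y₀, y₁, y₂, y₄`; `θ₄ = y₃ + 1 + y₀⁹ + y₁⁹ + y₂⁹` (= `θ₂₂`ʼs shape), `(a′, b′) = (y₃²²y₄⁴³, y₁² − y₂³)`.
* CHART 5: `X 0..4 = y₄, y₀, y₁, y₂, y₃`; `θ₅ = y₀²·y₄ + 1 + y₁⁹ + y₂⁹ + y₃⁹`, `(a′, b′) = (y₄²², y₂² − y₃³)`.
* CHART 18: `X 0..4 = y₃, y₀, y₁, y₂, y₄`; `θ₁₈ = (1 + y₀⁹ + y₁⁹ + y₂⁹)·y₃ + 1`, `(a′, b′) = (y₃²⁰y₄⁴³, y₀²y₂ − y₁³)`.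
* CHART 23: `X 0..4 = y₄, y₀, y₁, y₂, y₃`; `θ₂₃ = y₀²·y₄ + 1 + y₁⁹ + y₂⁹ + y₃⁹` (= `θ₅`ʼs shape), `(a′, b′) = (y₄²², y₃·y₁² − y₂³)`.
* §1 primality of the three shapes of `θ` (`prime_theta22` of ✓p707995 serves charts 4/22; `prime_theta5` charts 5/23; `prime_theta18`); §2 the evaluation points; §3 ★ eight CM theorems.
[cite: StacksProject, Tag 0BIQ; Matsumura1987, Thm. 17.4]
-/

set_option linter.dupNamespace false

noncomputable section

open AlgebraicGeometry MvPolynomial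

namespace Summit.ResolutionOfSingularities.ResolutionOfSingularities.Theorems.FInjectiveMacaulayfication.OmegaOneActualChartsCM

open Summit.ResolutionOfSingularities.ResolutionOfSingularities.Theorems.FInjectiveMacaulayfication
open SliceableCentre OmegaOneActualChart22CM

variable (k : Type) [Field k]

/-! ## §1 Primality of the chart equations -/

/-- `y₀² ∣ B·t ⇒ y₀² ∣ t` when `B` does not involve `y₀` in the strong sense `B(y₀ := 0) = B` and `B ≠ 0` — here for `B = −(1 + y₁⁹ + y₂⁹ + y₃⁹)`. [elementary] -/
theorem sq_X_regular (t : MvPolynomial (Fin 5) k) (h : -(C 1 + X 1 ^ 9 + X 2 ^ 9 + X 3 ^ 9) * t ∈ Ideal.span {(X 0 ^ 2 : MvPolynomial (Fin 5) k)}) :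
    t ∈ Ideal.span {(X 0 ^ 2 : MvPolynomial (Fin 5) k)} := by
  rw [Ideal.mem_span_singleton] at h ⊢
  have hX : Prime (X 0 : MvPolynomial (Fin 5) k) := X_prime
  have hB : ¬ (X 0 : MvPolynomial (Fin 5) k) ∣ -(C 1 + X 1 ^ 9 + X 2 ^ 9 + X 3 ^ 9) := by
    rintro ⟨q, hq⟩
    have h0 := congrArg (eval (![0, 0, 0, 0, 0] : Fin 5 → k)) hq
    simp [eval_X] at h0
  have h1 : (X 0 : MvPolynomial (Fin 5) k) ∣ t := by
    rcases hX.dvd_or_dvd (dvd_trans (dvd_pow_self (X 0) two_ne_zero) h) with h1 | h1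
    · exact absurd h1 hB
    · exact h1
  obtain ⟨t₁, rfl⟩ := h1
  have h2 : (X 0 : MvPolynomial (Fin 5) k) ^ 2 ∣ X 0 * (-(C 1 + X 1 ^ 9 + X 2 ^ 9 + X 3 ^ 9) * t₁) := by
    have : -(C 1 + X 1 ^ 9 + X 2 ^ 9 + X 3 ^ 9) * (X 0 * t₁) = X 0 * (-(C 1 + X 1 ^ 9 + X 2 ^ 9 + X 3 ^ 9) * t₁) := by ring
    rwa [this] at h
  rw [pow_two] at h2 ⊢
  have h3 : (X 0 : MvPolynomial (Fin 5) k) ∣ -(C 1 + X 1 ^ 9 + X 2 ^ 9 + X 3 ^ 9) * t₁ := (mul_dvd_mul_iff_left (hX.ne_zero)).1 h2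
  rcases hX.dvd_or_dvd h3 with h4 | h4
  · exact absurd h4 hB
  · exact mul_dvd_mul_left _ h4

/-- **`θ₅ = y₀²·y₄ + 1 + y₁⁹ + y₂⁹ + y₃⁹` IS PRIME** (letters `X 0 = y₄`, `X 1 = y₀`; also `θ₂₃`). [elementary; ✓ `prime_pencilPhiAffine` with `M = y₀²`] -/
theorem prime_theta5 : Prime (X 1 ^ 2 * X 0 + C 1 + X 2 ^ 9 + X 3 ^ 9 + X 4 ^ 9 : MvPolynomial (Fin 6) k) := by
  have h := PencilPhiPrime.prime_pencilPhiAffine k (X 0 ^ 2 : MvPolynomial (Fin 5) k) (-(C 1 + X 1 ^ 9 + X 2 ^ 9 + X 3 ^ 9))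
    (pow_ne_zero 2 (X_ne_zero 0)) (sq_X_regular k)
  have he : (rename Fin.succ (X 0 ^ 2 : MvPolynomial (Fin 5) k) * X 0 - rename Fin.succ (-(C 1 + X 1 ^ 9 + X 2 ^ 9 + X 3 ^ 9)) : MvPolynomial (Fin 6) k) =
      X 1 ^ 2 * X 0 + C 1 + X 2 ^ 9 + X 3 ^ 9 + X 4 ^ 9 := by
    simp only [map_neg, map_add, map_pow, rename_C, rename_X]
    have h0 : (Fin.succ (0 : Fin 5) : Fin 6) = 1 := rfl
    have h1 : (Fin.succ (1 : Fin 5) : Fin 6) = 2 := rfl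
    have h2 : (Fin.succ (2 : Fin 5) : Fin 6) = 3 := rfl
    have h3 : (Fin.succ (3 : Fin 5) : Fin 6) = 4 := rfl
    rw [h0, h1, h2, h3]; ring
  rwa [he] at h

/-- **`θ₁₈ = (1 + y₀⁹ + y₁⁹ + y₂⁹)·y₃ + 1` IS PRIME** (letters `X 0 = y₃`). [elementary; ✓ `prime_pencilPhiAffine` with `B = −1`] -/
theorem prime_theta18 : Prime ((C 1 + X 1 ^ 9 + X 2 ^ 9 + X 3 ^ 9) * X 0 + C 1 : MvPolynomial (Fin 6) k) := by
  have hM : (C 1 + X 0 ^ 9 + X 1 ^ 9 + X 2 ^ 9 : MvPolynomial (Fin 5) k) ≠ 0 := by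
    intro h0
    have := congrArg (eval (![0, 0, 0, 0, 0] : Fin 5 → k)) h0
    simp [eval_X] at this
  have h := PencilPhiPrime.prime_pencilPhiAffine k (C 1 + X 0 ^ 9 + X 1 ^ 9 + X 2 ^ 9 : MvPolynomial (Fin 5) k) (-C 1) hM
    (fun t ht => by rw [neg_mul, Ideal.neg_mem_iff, map_one, one_mul] at ht; exact ht)
  have he : (rename Fin.succ (C 1 + X 0 ^ 9 + X 1 ^ 9 + X 2 ^ 9 : MvPolynomial (Fin 5) k) * X 0 - rename Fin.succ (-C 1) : MvPolynomial (Fin 6) k) =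
      (C 1 + X 1 ^ 9 + X 2 ^ 9 + X 3 ^ 9) * X 0 + C 1 := by
    simp only [map_neg, map_add, map_pow, rename_C, rename_X]
    have h0 : (Fin.succ (0 : Fin 5) : Fin 6) = 1 := rfl
    have h1 : (Fin.succ (1 : Fin 5) : Fin 6) = 2 := rfl
    have h2 : (Fin.succ (2 : Fin 5) : Fin 6) = 3 := rfl
    rw [h0, h1, h2]; ring
  rwa [he] at h

/-! ## §2 Non-divisibility by evaluation -/

/-- `θ₄ ∤ y₁² − y₂³` (chart 4 letters; evaluate at `y₃ = −2, y₁ = 1`). [elementary] -/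
theorem theta22_not_dvd_cusp4 : ¬ (X 0 + C 1 + X 1 ^ 9 + X 2 ^ 9 + X 3 ^ 9 : MvPolynomial (Fin 6) k) ∣ X 2 ^ 2 - X 3 ^ 3 := by
  rintro ⟨q, hq⟩
  have h := congrArg (eval (![-2, 0, 1, 0, 0, 0] : Fin 6 → k)) hq
  simp [eval_X] at h
  norm_num at h

/-- `θ₅ ∤ y₄²²` (evaluate at `y₀ = 1, y₄ = −1`). [elementary] -/
theorem theta5_not_dvd_monomial : ¬ (X 1 ^ 2 * X 0 + C 1 + X 2 ^ 9 + X 3 ^ 9 + X 4 ^ 9 : MvPolynomial (Fin 6) k) ∣ X 0 ^ 22 := by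
  rintro ⟨q, hq⟩
  have h := congrArg (eval (![-1, 1, 0, 0, 0, 0] : Fin 6 → k)) hq
  simp [eval_X] at h

/-- `θ₅ ∤ y₂² − y₃³` (evaluate at `y₀ = 1, y₄ = −2, y₂ = 1`). [elementary] -/
theorem theta5_not_dvd_cusp : ¬ (X 1 ^ 2 * X 0 + C 1 + X 2 ^ 9 + X 3 ^ 9 + X 4 ^ 9 : MvPolynomial (Fin 6) k) ∣ X 3 ^ 2 - X 4 ^ 3 := by
  rintro ⟨q, hq⟩
  have h := congrArg (eval (![-2, 1, 0, 1, 0, 0] : Fin 6 → k)) hq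
  simp [eval_X] at h
  norm_num at h

/-- `θ₂₃ ∤ y₃·y₁² − y₂³` (evaluate at `y₄ = −1, y₀ = 1, y₁ = −1, y₃ = 1`). [elementary] -/
theorem theta5_not_dvd_cusp23 : ¬ (X 1 ^ 2 * X 0 + C 1 + X 2 ^ 9 + X 3 ^ 9 + X 4 ^ 9 : MvPolynomial (Fin 6) k) ∣ X 4 * X 2 ^ 2 - X 3 ^ 3 := by
  rintro ⟨q, hq⟩
  have h := congrArg (eval (![-1, 1, -1, 0, 1, 0] : Fin 6 → k)) hq
  simp [eval_X] at h
  norm_num at h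

/-- `θ₁₈ ∤ y₃²⁰y₄⁴³` (evaluate at `y₃ = −1, y₄ = 1`). [elementary] -/
theorem theta18_not_dvd_monomial : ¬ ((C 1 + X 1 ^ 9 + X 2 ^ 9 + X 3 ^ 9) * X 0 + C 1 : MvPolynomial (Fin 6) k) ∣ X 0 ^ 20 * X 4 ^ 43 := by
  rintro ⟨q, hq⟩
  have h := congrArg (eval (![-1, 0, 0, 0, 1, 0] : Fin 6 → k)) hq
  simp [eval_X] at h

/-- `θ₁₈ ∤ y₀²y₂ − y₁³` (evaluate at `y₃ = −1, y₀ = −1, y₂ = 1`). [elementary] -/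
theorem theta18_not_dvd_cusp : ¬ ((C 1 + X 1 ^ 9 + X 2 ^ 9 + X 3 ^ 9) * X 0 + C 1 : MvPolynomial (Fin 6) k) ∣ X 1 ^ 2 * X 3 - X 2 ^ 3 := by
  rintro ⟨q, hq⟩
  have h := congrArg (eval (![-1, -1, 0, 1, 0, 0] : Fin 6 → k)) hq
  simp [eval_X] at h
  norm_num at h

/-! ## §3 ★ CM at every stalk of the eight actual pencil chart rings -/

/-- ★ CHART 4, `W`-chart: `k[y,W]/(θ₄, y₃²²y₄⁴³·W − (y₁² − y₂³))` is CM at every stalk. [OURS · F4 (c); cite: StacksProject, Tag 0BIQ; Matsumura1987, Thm. 17.4] -/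
theorem cmCl_actualChart4_W
    (y : Spec (.of (MvPolynomial (Fin 6) k ⧸ Ideal.span {(X 0 + C 1 + X 1 ^ 9 + X 2 ^ 9 + X 3 ^ 9 : MvPolynomial (Fin 6) k), X 0 ^ 22 * X 4 ^ 43 * X 5 - (X 2 ^ 2 - X 3 ^ 3)}))) :
    CMCl ((Spec (.of (MvPolynomial (Fin 6) k ⧸ Ideal.span {(X 0 + C 1 + X 1 ^ 9 + X 2 ^ 9 + X 3 ^ 9 : MvPolynomial (Fin 6) k), X 0 ^ 22 * X 4 ^ 43 * X 5 - (X 2 ^ 2 - X 3 ^ 3)}))).presheaf.stalk y) :=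
  CICodimTwoCM.cmCl_stalk_of_prime_of_not_dvd k _ _ (prime_theta22 k)
    (PencilFedder.not_dvd_pencil_of_not_dvd k 5 _ _ _ (by simp [pderiv_X]) (by simp [pderiv_X]) (by simp [pderiv_X]) (theta22_not_dvd_monomial k)) y

/-- ★ CHART 4, `U`-chart: `k[y,U]/(θ₄, (y₁² − y₂³)·U − y₃²²y₄⁴³)` is CM at every stalk. [OURS · F4 (c)] -/
theorem cmCl_actualChart4_U
    (y : Spec (.of (MvPolynomial (Fin 6) k ⧸ Ideal.span {(X 0 + C 1 + X 1 ^ 9 + X 2 ^ 9 + X 3 ^ 9 : MvPolynomial (Fin 6) k), (X 2 ^ 2 - X 3 ^ 3) * X 5 - X 0 ^ 22 * X 4 ^ 43}))) :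
    CMCl ((Spec (.of (MvPolynomial (Fin 6) k ⧸ Ideal.span {(X 0 + C 1 + X 1 ^ 9 + X 2 ^ 9 + X 3 ^ 9 : MvPolynomial (Fin 6) k), (X 2 ^ 2 - X 3 ^ 3) * X 5 - X 0 ^ 22 * X 4 ^ 43}))).presheaf.stalk y) :=
  CICodimTwoCM.cmCl_stalk_of_prime_of_not_dvd k _ _ (prime_theta22 k)
    (PencilFedder.not_dvd_pencil_of_not_dvd k 5 _ _ _ (by simp [pderiv_X]) (by simp [pderiv_X]) (by simp [pderiv_X]) (theta22_not_dvd_cusp4 k)) y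

/-- ★ CHART 5, `W`-chart: `k[y,W]/(θ₅, y₄²²·W − (y₂² − y₃³))` is CM at every stalk. [OURS · F4 (c)] -/
theorem cmCl_actualChart5_W
    (y : Spec (.of (MvPolynomial (Fin 6) k ⧸ Ideal.span {(X 1 ^ 2 * X 0 + C 1 + X 2 ^ 9 + X 3 ^ 9 + X 4 ^ 9 : MvPolynomial (Fin 6) k), X 0 ^ 22 * X 5 - (X 3 ^ 2 - X 4 ^ 3)}))) :
    CMCl ((Spec (.of (MvPolynomial (Fin 6) k ⧸ Ideal.span {(X 1 ^ 2 * X 0 + C 1 + X 2 ^ 9 + X 3 ^ 9 + X 4 ^ 9 : MvPolynomial (Fin 6) k), X 0 ^ 22 * X 5 - (X 3 ^ 2 - X 4 ^ 3)}))).presheaf.stalk y) :=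
  CICodimTwoCM.cmCl_stalk_of_prime_of_not_dvd k _ _ (prime_theta5 k)
    (PencilFedder.not_dvd_pencil_of_not_dvd k 5 _ _ _ (by simp [pderiv_X]) (by simp [pderiv_X]) (by simp [pderiv_X]) (theta5_not_dvd_monomial k)) y

/-- ★ CHART 5, `U`-chart: `k[y,U]/(θ₅, (y₂² − y₃³)·U − y₄²²)` is CM at every stalk. [OURS · F4 (c)] -/
theorem cmCl_actualChart5_U
    (y : Spec (.of (MvPolynomial (Fin 6) k ⧸ Ideal.span {(X 1 ^ 2 * X 0 + C 1 + X 2 ^ 9 + X 3 ^ 9 + X 4 ^ 9 : MvPolynomial (Fin 6) k), (X 3 ^ 2 - X 4 ^ 3) * X 5 - X 0 ^ 22}))) :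
    CMCl ((Spec (.of (MvPolynomial (Fin 6) k ⧸ Ideal.span {(X 1 ^ 2 * X 0 + C 1 + X 2 ^ 9 + X 3 ^ 9 + X 4 ^ 9 : MvPolynomial (Fin 6) k), (X 3 ^ 2 - X 4 ^ 3) * X 5 - X 0 ^ 22}))).presheaf.stalk y) :=
  CICodimTwoCM.cmCl_stalk_of_prime_of_not_dvd k _ _ (prime_theta5 k)
    (PencilFedder.not_dvd_pencil_of_not_dvd k 5 _ _ _ (by simp [pderiv_X]) (by simp [pderiv_X]) (by simp [pderiv_X]) (theta5_not_dvd_cusp k)) y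

/-- ★ CHART 18, `W`-chart: `k[y,W]/(θ₁₈, y₃²⁰y₄⁴³·W − (y₀²y₂ − y₁³))` is CM at every stalk. [OURS · F4 (c)] -/
theorem cmCl_actualChart18_W
    (y : Spec (.of (MvPolynomial (Fin 6) k ⧸ Ideal.span {((C 1 + X 1 ^ 9 + X 2 ^ 9 + X 3 ^ 9) * X 0 + C 1 : MvPolynomial (Fin 6) k), X 0 ^ 20 * X 4 ^ 43 * X 5 - (X 1 ^ 2 * X 3 - X 2 ^ 3)}))) :
    CMCl ((Spec (.of (MvPolynomial (Fin 6) k ⧸ Ideal.span {((C 1 + X 1 ^ 9 + X 2 ^ 9 + X 3 ^ 9) * X 0 + C 1 : MvPolynomial (Fin 6) k), X 0 ^ 20 * X 4 ^ 43 * X 5 - (X 1 ^ 2 * X 3 - X 2 ^ 3)}))).presheaf.stalk y) :=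
  CICodimTwoCM.cmCl_stalk_of_prime_of_not_dvd k _ _ (prime_theta18 k)
    (PencilFedder.not_dvd_pencil_of_not_dvd k 5 _ _ _ (by simp [pderiv_X]) (by simp [pderiv_X]) (by simp [pderiv_X]) (theta18_not_dvd_monomial k)) y

/-- ★ CHART 18, `U`-chart: `k[y,U]/(θ₁₈, (y₀²y₂ − y₁³)·U − y₃²⁰y₄⁴³)` is CM at every stalk. [OURS · F4 (c)] -/
theorem cmCl_actualChart18_U
    (y : Spec (.of (MvPolynomial (Fin 6) k ⧸ Ideal.span {((C 1 + X 1 ^ 9 + X 2 ^ 9 + X 3 ^ 9) * X 0 + C 1 : MvPolynomial (Fin 6) k), (X 1 ^ 2 * X 3 - X 2 ^ 3) * X 5 - X 0 ^ 20 * X 4 ^ 43}))) :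
    CMCl ((Spec (.of (MvPolynomial (Fin 6) k ⧸ Ideal.span {((C 1 + X 1 ^ 9 + X 2 ^ 9 + X 3 ^ 9) * X 0 + C 1 : MvPolynomial (Fin 6) k), (X 1 ^ 2 * X 3 - X 2 ^ 3) * X 5 - X 0 ^ 20 * X 4 ^ 43}))).presheaf.stalk y) :=
  CICodimTwoCM.cmCl_stalk_of_prime_of_not_dvd k _ _ (prime_theta18 k)
    (PencilFedder.not_dvd_pencil_of_not_dvd k 5 _ _ _ (by simp [pderiv_X]) (by simp [pderiv_X]) (by simp [pderiv_X]) (theta18_not_dvd_cusp k)) y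

/-- ★ CHART 23, `W`-chart: `k[y,W]/(θ₂₃, y₄²²·W − (y₃y₁² − y₂³))` is CM at every stalk. [OURS · F4 (c)] -/
theorem cmCl_actualChart23_W
    (y : Spec (.of (MvPolynomial (Fin 6) k ⧸ Ideal.span {(X 1 ^ 2 * X 0 + C 1 + X 2 ^ 9 + X 3 ^ 9 + X 4 ^ 9 : MvPolynomial (Fin 6) k), X 0 ^ 22 * X 5 - (X 4 * X 2 ^ 2 - X 3 ^ 3)}))) :
    CMCl ((Spec (.of (MvPolynomial (Fin 6) k ⧸ Ideal.span {(X 1 ^ 2 * X 0 + C 1 + X 2 ^ 9 + X 3 ^ 9 + X 4 ^ 9 : MvPolynomial (Fin 6) k), X 0 ^ 22 * X 5 - (X 4 * X 2 ^ 2 - X 3 ^ 3)}))).presheaf.stalk y) :=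
  CICodimTwoCM.cmCl_stalk_of_prime_of_not_dvd k _ _ (prime_theta5 k)
    (PencilFedder.not_dvd_pencil_of_not_dvd k 5 _ _ _ (by simp [pderiv_X]) (by simp [pderiv_X]) (by simp [pderiv_X]) (theta5_not_dvd_monomial k)) y

/-- ★ CHART 23, `U`-chart: `k[y,U]/(θ₂₃, (y₃y₁² − y₂³)·U − y₄²²)` is CM at every stalk. [OURS · F4 (c)] -/
theorem cmCl_actualChart23_U
    (y : Spec (.of (MvPolynomial (Fin 6) k ⧸ Ideal.span {(X 1 ^ 2 * X 0 + C 1 + X 2 ^ 9 + X 3 ^ 9 + X 4 ^ 9 : MvPolynomial (Fin 6) k), (X 4 * X 2 ^ 2 - X 3 ^ 3) * X 5 - X 0 ^ 22}))) :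
    CMCl ((Spec (.of (MvPolynomial (Fin 6) k ⧸ Ideal.span {(X 1 ^ 2 * X 0 + C 1 + X 2 ^ 9 + X 3 ^ 9 + X 4 ^ 9 : MvPolynomial (Fin 6) k), (X 4 * X 2 ^ 2 - X 3 ^ 3) * X 5 - X 0 ^ 22}))).presheaf.stalk y) :=
  CICodimTwoCM.cmCl_stalk_of_prime_of_not_dvd k _ _ (prime_theta5 k)
    (PencilFedder.not_dvd_pencil_of_not_dvd k 5 _ _ _ (by simp [pderiv_X]) (by simp [pderiv_X]) (by simp [pderiv_X]) (theta5_not_dvd_cusp23 k)) y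

end Summit.ResolutionOfSingularities.ResolutionOfSingularities.Theorems.FInjectiveMacaulayfication.OmegaOneActualChartsCM

end
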